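import Mathlib

/-!
# Connectivity correlation inequalities for `φ_{w,q}`, every `q > 0` — ROOT-FORM CALCULUS, file 61d: the 40-term certificate of THEOREM G27
# (♣ ≥ 0 for every pair of boxes) as a kernel-checked table

Support file (`--supports stmt-CriticalPhenomena-4575`), FK sub-lane `prim-bschramm-fk-2` (gen 28); builds on p205010 (kernel theorem, internal audit
signed; external expert review pending).  Standard axioms, no sorries.  Memo FROM-fk-2-g27-ONEEAR-NF.md §4 (the certificate, kit j203935) and
FROM-fk-2-g28-ROOT-FORM.md §6–§7 ((B1) = ♣ ≥ 0 is the base of the word theorem `FK.RootForm.spine_root_nonneg`).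

Everything here is at the level of LOCAL TYPES of a one-special box (`BT`: the pole-connection bits at the two states of the special and the
level difference `dL = L¹ − L⁰ ∈ {−1,0,1}`, with the consistency constraints `c⁰ ≤ c¹`, `c̄¹ ≤ c̄⁰`, `(c⁰,c¹)=(0,1) ⇒ dL ≤ 0`, `(c̄⁰,c̄¹)=(1,0) ⇒ dL ≥ 0`
— 21 types) and is COMPUTABLE over `ℤ`: the single-box generator integrands `A1` (pivot, virtual root contracted), `A3u/A3l` (pivot, root free,
upper/lower part), `A4u/A4l` (root-U at the exact level of state 1 / state 0); the two slot integrands `X1, X0` of the nested root functional ♣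
of the pair `B_y ∥ B_z` as functions of `(t_y, t_z, k = J − L⁰_y − L⁰_z)`; the certificate `certY, certZ` (40 instances, multipliers 1 and 2,
keyed by the PARTNER's connection class, thresholds `k − [ref]·dL_partner + d`, `d ∈ {0,−1}`); the residual `rho = (ρ₁, ρ₀)`; and the theorem
`rho_nonneg`: `ρ₁ ≥ 0 ∧ ρ₁ + ρ₀ ≥ 0` for all consistent type pairs and ALL `k` (the window `k ∈ [−8,9]` by `decide +kernel` over the 7,938 rows,
outside the window every bracket is saturated).  File 61e turns this into ♣ ≥ 0 for abstract boxes. [folklore]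
-/

namespace Summit.CriticalPhenomena.PercolationContinuityZ3.Theorems

namespace FK

namespace RootForm

namespace Cert

/-- Local type of a one-special box at a configuration: pole bits at special-state 0/1 in replica 1 (`c0,c1`) and replica 2 (`cb0,cb1`),
and the level difference `dL = L¹ − L⁰`. [folklore] -/
structure BT where
  /-- poles joined in replica 1, special in replica 2 -/
  c0 : Bool
  /-- poles joined in replica 1, special in replica 1 -/
  c1 : Bool
  /-- poles joined in replica 2, special in replica 2 -/
  cb0 : Bool
  /-- poles joined in replica 2, special in replica 1 -/
  cb1 : Bool
  /-- `L¹ − L⁰` -/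
  dL : ℤ
deriving DecidableEq

/-- The consistency constraints of a local type (Boolean form). [folklore] -/
def consistentB (t : BT) : Bool :=
  (!t.c0 || t.c1) && (!t.cb1 || t.cb0) && decide (-1 ≤ t.dL) && decide (t.dL ≤ 1) &&
    (!(!t.c0 && t.c1) || decide (t.dL ≤ 0)) && (!(t.cb0 && !t.cb1) || decide (0 ≤ t.dL))

/-- All 48 sign patterns with `dL ∈ {−1,0,1}`. [folklore] -/
def allT : List BT :=
  [false, true].flatMap fun c0 => [false, true].flatMap fun c1 => [false, true].flatMap fun cb0 => [false, true].flatMap fun cb1 =>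
    [-1, 0, 1].map fun dL => (⟨c0, c1, cb0, cb1, dL⟩ : BT)

/-- The 21 consistent local types. [folklore] -/
def T21 : List BT := allT.filter consistentB

/-- Integer indicator. [folklore] -/
def I (p : Prop) [Decidable p] : ℤ := if p then 1 else 0
/-- Integer value of a Boolean. [folklore] -/
def bi (b : Bool) : ℤ := if b then 1 else 0
/-- level of state `s` relative to `L⁰`. [folklore] -/
def lev (t : BT) (s : Bool) : ℤ := if s then t.dL else 0
/-- replica-1 pole bit at state `s`. [folklore] -/
def ccB (t : BT) (s : Bool) : Bool := if s then t.c1 else t.c0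
/-- replica-2 pole bit at state `s`. [folklore] -/
def cbB (t : BT) (s : Bool) : Bool := if s then t.cb1 else t.cb0

/-- A1 (pivot at the special, virtual root contracted): `[L⁰+c⁰+c̄⁰ ≤ K] − [L¹+c¹+c̄¹ ≤ K]`. [folklore] -/
def A1 (t : BT) (K : ℤ) : ℤ := I (bi t.c0 + bi t.cb0 ≤ K) - I (t.dL + bi t.c1 + bi t.cb1 ≤ K)
/-- upper part of A3n (pivot, root free, root in replica 1): `[L⁰+c⁰ ≤ K] − [L¹+c¹ ≤ K]`. [folklore] -/
def A3u (t : BT) (K : ℤ) : ℤ := I (bi t.c0 ≤ K) - I (t.dL + bi t.c1 ≤ K)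
/-- lower part of A3n (root in replica 2): `[L⁰+c̄⁰ ≤ K] − [L¹+c̄¹ ≤ K]`. [folklore] -/
def A3l (t : BT) (K : ℤ) : ℤ := I (bi t.cb0 ≤ K) - I (t.dL + bi t.cb1 ≤ K)
/-- upper part of root-U at exact level (state 1): `[L¹ = K](c¹ − c̄¹)`. [folklore] -/
def A4u (t : BT) (K : ℤ) : ℤ := I (t.dL = K) * (bi t.c1 - bi t.cb1)
/-- lower part of root-U at exact level (state 0): `[L⁰ = K](c⁰ − c̄⁰)`. [folklore] -/
def A4l (t : BT) (K : ℤ) : ℤ := I (0 = K) * (bi t.c0 - bi t.cb0)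

/-- level of the pair `B_y ∥ B_z` at states `(a,b)` relative to `L⁰_y + L⁰_z`. [folklore] -/
def plam (ty tz : BT) (a b : Bool) : ℤ := lev ty a + lev tz b + bi (ccB ty a && ccB tz b) + bi (cbB ty a && cbB tz b)
/-- pole bit of the pair in replica 1. [folklore] -/
def C1 (ty tz : BT) (a b : Bool) : ℤ := bi (ccB ty a || ccB tz b)
/-- pole bit of the pair in replica 2. [folklore] -/
def C2 (ty tz : BT) (a b : Bool) : ℤ := bi (cbB ty a || cbB tz b)
/-- slot-1 integrand of ♣ = M̃_{B_y∥B_z} at `k = J − L⁰_y − L⁰_z`. [folklore] -/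
def X1 (ty tz : BT) (k : ℤ) : ℤ :=
  I (plam ty tz false false + C1 ty tz false false ≤ k) - I (plam ty tz true true + C1 ty tz true true ≤ k)
  + I (plam ty tz true false = k) * C1 ty tz true false + I (plam ty tz false true = k) * C1 ty tz false true
/-- slot-0 integrand of ♣. [folklore] -/
def X0 (ty tz : BT) (k : ℤ) : ℤ :=
  I (plam ty tz false false + C2 ty tz false false ≤ k) - I (plam ty tz true true + C2 ty tz true true ≤ k)
  - I (plam ty tz true false = k) * C2 ty tz true false - I (plam ty tz false true = k) * C2 ty tz false true

/-- indicator of the connection class `(c0,c1,cb0,cb1)` of a type. [folklore] -/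
def isC (t : BT) (a b c d : Bool) : ℤ := if (t.c0, t.c1, t.cb0, t.cb1) = (a, b, c, d) then 1 else 0

/-- y-side of the 40-term certificate (generators of box `y`, keyed by the class of `t_z`); thresholds `K0 = k`, `K0m = k − 1`,
`K1 = k − dL_z`, `K1m = k − dL_z − 1` are passed explicitly; returns (slot-1 part, slot-0 part). [folklore] -/
def certY (ty tz : BT) (K0 K0m K1 K1m : ℤ) : ℤ × ℤ :=
  ((isC tz false false true false + isC tz false false true true + isC tz false true true false + isC tz false true true true) * A1 ty K0
      + isC tz true true true false * A1 ty K0m + 2 * isC tz true true true true * A1 ty K0m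
      + (isC tz false false false false + isC tz false true false false) * A3u ty K0 + isC tz true true false false * A3u ty K0m
      + isC tz false false false false * (A4u ty K1 + A4l ty K1)
      + (isC tz false true false false + isC tz true true false false) * (A4u ty K1m + A4l ty K1m)
      + isC tz false false true false * A4u ty K1 + isC tz false true true false * A4u ty K0m + isC tz true true true false * A4u ty K1m,
    (isC tz false false true false + isC tz false false true true + isC tz false true true false + isC tz false true true true) * A1 ty K0
      + isC tz true true true false * A1 ty K0m
      + (isC tz false false false false + isC tz false true false false) * A3l ty K0 + isC tz true true false false * A3l ty K0m
      + isC tz false false true false * A4l ty K1 + isC tz false true true false * A4l ty K0m + isC tz true true true false * A4l ty K1m)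

/-- z-side of the certificate (generators of box `z`, keyed by the class of `t_y`); thresholds `K0 = k`, `K0m = k − 1`, `K1 = k − dL_y`,
`K1m = k − dL_y − 1`. [folklore] -/
def certZ (ty tz : BT) (K0 K0m K1 K1m : ℤ) : ℤ × ℤ :=
  (isC ty false true false false * A1 tz K1 + isC ty false true true true * A1 tz K1m + isC ty true true false false * A1 tz K1
      + isC ty true true true false * A1 tz K1 + isC ty true true true true * A1 tz K1m
      + (isC ty false false false false + isC ty false false true false) * A3u tz K1 + isC ty false false true true * A3u tz K1m
      + (isC ty false false false false + isC ty false true false false) * A4u tz K0,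
    isC ty false true false false * A1 tz K1 + 2 * isC ty false true true false * A1 tz K0 + isC ty false true true true * A1 tz K1m
      + isC ty true true false false * A1 tz K1 + isC ty true true true false * A1 tz K1 + isC ty true true true true * A1 tz K1m
      + (isC ty false false false false + isC ty false false true false) * A3l tz K1 + isC ty false false true true * A3l tz K1m
      + (isC ty false false true false + isC ty false false true true + isC ty false true true false + isC ty false true true true)
          * (A4u tz K0m + A4l tz K0m)
      + (isC ty false false false false + isC ty false true false false) * A4l tz K0)

/-- The residual `(ρ₁, ρ₀) := (X1, X0) − certY − certZ`. [folklore] -/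
def rho (ty tz : BT) (k : ℤ) : ℤ × ℤ :=
  (X1 ty tz k - (certY ty tz k (k - 1) (k - tz.dL) (k - tz.dL - 1)).1 - (certZ ty tz k (k - 1) (k - ty.dL) (k - ty.dL - 1)).1,
   X0 ty tz k - (certY ty tz k (k - 1) (k - tz.dL) (k - tz.dL - 1)).2 - (certZ ty tz k (k - 1) (k - ty.dL) (k - ty.dL - 1)).2)

/-- the window of offsets. [folklore] -/
def ks : List ℤ := [-8, -7, -6, -5, -4, -3, -2, -1, 0, 1, 2, 3, 4, 5, 6, 7, 8, 9]

/-- the transport conditions `ρ₁ ≥ 0`, `ρ₁ + ρ₀ ≥ 0` at one row. [folklore] -/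
def checkRow (ty tz : BT) (k : ℤ) : Bool :=
  decide (0 ≤ (rho ty tz k).1) && decide (0 ≤ (rho ty tz k).1 + (rho ty tz k).2)

/-- all 21 × 21 × 18 rows. [folklore] -/
def checkAll : Bool := T21.all fun ty => T21.all fun tz => ks.all fun k => checkRow ty tz k

/-- **The certificate is valid on the window** (kernel evaluation of the 7,938 rows). [folklore] -/
theorem checkAll_true : checkAll = true := by decide +kernel

/-- A consistent type is one of the 21. [folklore] -/
theorem mem_T21 (t : BT) (h : consistentB t = true) : t ∈ T21 := by
  rw [T21, List.mem_filter]; refine ⟨?_, h⟩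
  obtain ⟨c0, c1, cb0, cb1, dL⟩ := t
  have hd : dL = -1 ∨ dL = 0 ∨ dL = 1 := by
    simp [consistentB] at h; omega
  rcases hd with h1 | h1 | h1 <;> subst h1 <;> cases c0 <;> cases c1 <;> cases cb0 <;> cases cb1 <;> decide

/-- Membership in the window. [folklore] -/
theorem mem_ks (k : ℤ) (h1 : -8 ≤ k) (h2 : k ≤ 9) : k ∈ ks := by
  interval_cases k <;> decide

/-- Residual conditions inside the window, from `checkAll_true`. [folklore] -/
theorem rho_window (ty tz : BT) (hy : consistentB ty = true) (hz : consistentB tz = true) (k : ℤ) (h1 : -8 ≤ k) (h2 : k ≤ 9) :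
    0 ≤ (rho ty tz k).1 ∧ 0 ≤ (rho ty tz k).1 + (rho ty tz k).2 := by
  have h := checkAll_true
  rw [checkAll, List.all_eq_true] at h
  have h' := h ty (mem_T21 ty hy); rw [List.all_eq_true] at h'
  have h'' := h' tz (mem_T21 tz hz); rw [List.all_eq_true] at h''
  have h3 := h'' k (mem_ks k h1 h2)
  simp only [checkRow, Bool.and_eq_true, decide_eq_true_eq] at h3
  exact h3

/-- `bi b ∈ {0,1}`. [folklore] -/
theorem bi_bound (b : Bool) : 0 ≤ bi b ∧ bi b ≤ 1 := by cases b <;> simp [bi]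
/-- a false `≤`-bracket. [folklore] -/
theorem I_le_false {e K : ℤ} (h : K < e) : I (e ≤ K) = 0 := by simp [I, not_le.2 h]
/-- a true `≤`-bracket. [folklore] -/
theorem I_le_true {e K : ℤ} (h : e ≤ K) : I (e ≤ K) = 1 := by simp [I, h]
/-- a false `=`-bracket. [folklore] -/
theorem I_eq_false {e K : ℤ} (h : e ≠ K) : I (e = K) = 0 := by simp [I, h]

/-- the level difference of a consistent type is in `[−1,1]`. [folklore] -/
theorem dL_bound (t : BT) (h : consistentB t = true) : -1 ≤ t.dL ∧ t.dL ≤ 1 := by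
  simp [consistentB] at h; omega

/-- A1 vanishes far from the support. [folklore] -/
theorem A1_sat (t : BT) (hd : -1 ≤ t.dL ∧ t.dL ≤ 1) (K : ℤ) (hK : K ≤ -3 ∨ 3 ≤ K) : A1 t K = 0 := by
  have h1 := bi_bound t.c0; have h2 := bi_bound t.cb0; have h3 := bi_bound t.c1; have h4 := bi_bound t.cb1
  unfold A1; rcases hK with hK | hK
  · rw [I_le_false (by omega), I_le_false (by omega)]; simp
  · rw [I_le_true (by omega), I_le_true (by omega)]; simp
/-- A3u vanishes far from the support. [folklore] -/
theorem A3u_sat (t : BT) (hd : -1 ≤ t.dL ∧ t.dL ≤ 1) (K : ℤ) (hK : K ≤ -3 ∨ 3 ≤ K) : A3u t K = 0 := by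
  have h1 := bi_bound t.c0; have h3 := bi_bound t.c1
  unfold A3u; rcases hK with hK | hK
  · rw [I_le_false (by omega), I_le_false (by omega)]; simp
  · rw [I_le_true (by omega), I_le_true (by omega)]; simp
/-- A3l vanishes far from the support. [folklore] -/
theorem A3l_sat (t : BT) (hd : -1 ≤ t.dL ∧ t.dL ≤ 1) (K : ℤ) (hK : K ≤ -3 ∨ 3 ≤ K) : A3l t K = 0 := by
  have h2 := bi_bound t.cb0; have h4 := bi_bound t.cb1
  unfold A3l; rcases hK with hK | hK
  · rw [I_le_false (by omega), I_le_false (by omega)]; simp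
  · rw [I_le_true (by omega), I_le_true (by omega)]; simp
/-- A4u vanishes far from the support. [folklore] -/
theorem A4u_sat (t : BT) (hd : -1 ≤ t.dL ∧ t.dL ≤ 1) (K : ℤ) (hK : K ≤ -3 ∨ 3 ≤ K) : A4u t K = 0 := by
  unfold A4u; rw [I_eq_false (by omega)]; simp
/-- A4l vanishes far from the support. [folklore] -/
theorem A4l_sat (t : BT) (K : ℤ) (hK : K ≤ -3 ∨ 3 ≤ K) : A4l t K = 0 := by
  unfold A4l; rw [I_eq_false (by omega)]; simp

/-- bounds of the pair level. [folklore] -/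
theorem plam_bound (ty tz : BT) (hy : -1 ≤ ty.dL ∧ ty.dL ≤ 1) (hz : -1 ≤ tz.dL ∧ tz.dL ≤ 1) (a b : Bool) :
    -2 ≤ plam ty tz a b ∧ plam ty tz a b ≤ 4 := by
  have h1 := bi_bound (ccB ty a && ccB tz b); have h2 := bi_bound (cbB ty a && cbB tz b)
  unfold plam lev; cases a <;> cases b <;> simp <;> omega
/-- bounds of the pair pole bits. [folklore] -/
theorem C1_bound (ty tz : BT) (a b : Bool) : 0 ≤ C1 ty tz a b ∧ C1 ty tz a b ≤ 1 := bi_bound _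
/-- see `C1_bound`. [folklore] -/
theorem C2_bound (ty tz : BT) (a b : Bool) : 0 ≤ C2 ty tz a b ∧ C2 ty tz a b ≤ 1 := bi_bound _

/-- `X1` vanishes far from the support. [folklore] -/
theorem X1_sat (ty tz : BT) (hy : -1 ≤ ty.dL ∧ ty.dL ≤ 1) (hz : -1 ≤ tz.dL ∧ tz.dL ≤ 1) (k : ℤ) (hk : k ≤ -5 ∨ 6 ≤ k) :
    X1 ty tz k = 0 := by
  have p00 := plam_bound ty tz hy hz false false; have p11 := plam_bound ty tz hy hz true true
  have p10 := plam_bound ty tz hy hz true false; have p01 := plam_bound ty tz hy hz false true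
  have c00 := C1_bound ty tz false false; have c11 := C1_bound ty tz true true
  unfold X1; rcases hk with hk | hk
  · rw [I_le_false (by omega), I_le_false (by omega), I_eq_false (by omega), I_eq_false (by omega)]; simp
  · rw [I_le_true (by omega), I_le_true (by omega), I_eq_false (by omega), I_eq_false (by omega)]; simp
/-- `X0` vanishes far from the support. [folklore] -/
theorem X0_sat (ty tz : BT) (hy : -1 ≤ ty.dL ∧ ty.dL ≤ 1) (hz : -1 ≤ tz.dL ∧ tz.dL ≤ 1) (k : ℤ) (hk : k ≤ -5 ∨ 6 ≤ k) :
    X0 ty tz k = 0 := by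
  have p00 := plam_bound ty tz hy hz false false; have p11 := plam_bound ty tz hy hz true true
  have p10 := plam_bound ty tz hy hz true false; have p01 := plam_bound ty tz hy hz false true
  have c00 := C2_bound ty tz false false; have c11 := C2_bound ty tz true true
  unfold X0; rcases hk with hk | hk
  · rw [I_le_false (by omega), I_le_false (by omega), I_eq_false (by omega), I_eq_false (by omega)]; simp
  · rw [I_le_true (by omega), I_le_true (by omega), I_eq_false (by omega), I_eq_false (by omega)]; simp

/-- Outside the window the residual vanishes (every bracket is saturated). [folklore] -/
theorem rho_sat (ty tz : BT) (hy : consistentB ty = true) (hz : consistentB tz = true) (k : ℤ) (hk : k ≤ -9 ∨ 10 ≤ k) :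
    rho ty tz k = (0, 0) := by
  have dy := dL_bound ty hy; have dz := dL_bound tz hz
  have hX1 := X1_sat ty tz dy dz k (by omega); have hX0 := X0_sat ty tz dy dz k (by omega)
  simp only [rho, certY, certZ, hX1, hX0,
    A1_sat ty dy k (by omega), A1_sat ty dy (k - 1) (by omega), A1_sat tz dz (k - ty.dL) (by omega),
    A1_sat tz dz (k - ty.dL - 1) (by omega), A1_sat tz dz k (by omega),
    A3u_sat ty dy k (by omega), A3u_sat ty dy (k - 1) (by omega), A3l_sat ty dy k (by omega), A3l_sat ty dy (k - 1) (by omega),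
    A3u_sat tz dz (k - ty.dL) (by omega), A3u_sat tz dz (k - ty.dL - 1) (by omega),
    A3l_sat tz dz (k - ty.dL) (by omega), A3l_sat tz dz (k - ty.dL - 1) (by omega),
    A4u_sat ty dy (k - tz.dL) (by omega), A4u_sat ty dy (k - tz.dL - 1) (by omega), A4u_sat ty dy (k - 1) (by omega),
    A4l_sat ty (k - tz.dL) (by omega), A4l_sat ty (k - tz.dL - 1) (by omega), A4l_sat ty (k - 1) (by omega),
    A4u_sat tz dz (k - 1) (by omega), A4l_sat tz (k - 1) (by omega), A4u_sat tz dz k (by omega), A4l_sat tz k (by omega)]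
  simp

/-- **Residual of the certificate**: for all consistent type pairs and every offset, `ρ₁ ≥ 0` and `ρ₁ + ρ₀ ≥ 0`. [folklore] -/
theorem rho_nonneg (ty tz : BT) (hy : consistentB ty = true) (hz : consistentB tz = true) (k : ℤ) :
    0 ≤ (rho ty tz k).1 ∧ 0 ≤ (rho ty tz k).1 + (rho ty tz k).2 := by
  by_cases hk : k ≤ -9 ∨ 10 ≤ k
  · rw [rho_sat ty tz hy hz k hk]; simp
  · exact rho_window ty tz hy hz k (by omega) (by omega)

end Cert

end RootForm

end FK

end Summit.CriticalPhenomena.PercolationContinuityZ3.Theorems
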